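/-
Copyright: the b2b-balaban T⁴-continuum CRUX team, row NE7b OWNER lineage `t4-ne7b-p1` (gen 124). Project licence.
-/
import Summits.QuantumFields.BalabanUV.T4Continuum.Spine.NE7b.SupZdPerturbedCoarseInverseLipschitz

/-!
# KERNEL ALGEBRA ON `ℤ^d`, II: TWO-SIDED DECAYING INVERSES ARE STABLE UNDER SMALL DECAYING PERTURBATIONS — for kernels `T, M` with
# exponential decay and `TM = 1 = MT`, and a perturbation `|E(b,c)| ≤ ηe^{−γ_E|b−c|₁}` with `θ = (C_Me^{νd}K_{δ_M−ν})(ηe^{νd}K_{γ_E−ν}) ≤ 1∕2`: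
# `T + E` has a two-sided inverse `N` in the decaying class, `|N| ≤ 2C_M′e^{−ν|b−c|₁}`, `|N − M| ≤ 2C_M′θe^{−ν|b−c|₁}`, unique on either side —
# the abstract form of (218)∕(219) (which are its instance `T = T_0`, `E = T_K − T_0`), stated ONCE for every later use: Lipschitz dependence of
# next-scale Hessians on `V`, on `K`, and the identification of torus → `ℤ^d` limits by uniqueness (row NE7b, node U5c; (217)∕(219) BY NAME; [folklore])

Cell `pub-balaban`, sub-cell `t4`, spine estimate NE7b (`T4WeightBudget.RelWeightBound`; the cell's OWN estimate — NOT PRINTED in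
[Bałaban 1983–89], NOT PROVED).  Crux-route work under `Spine/NE7b/` by the row OWNER (`t4-ne7b-p1` gen 124, file (226)) under FREEZE
(0)'s crux-prover clause; NOTHING of Bałaban's is named as a Lean object, valued or asserted; no `T4Continuum/Support` leaf typed; no `def`,
no notation; zero `sorry`; no road object at all (pure kernel algebra).  Imports (BY NAME): the OWNER's (219) `…SupZdPerturbedCoarseInverseLipschitz`
(`fixed_point_lipschitz`; through it (217) `decaying_right_inverse`, `left_inverse_eq_right_inverse`, (191) `natAbs_sub_comm_sum`).

WHY (located).  The ADDENDUM's NEXT item (b) — the torus → `ℤ^d` limit of the `H + K` tower — ends with an IDENTIFICATION: whatever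
decaying kernel the torus inverses converge to must be `N_K`, because decaying one-sided inverses of `T_K` are unique; and every
"Lipschitz in the data" statement for next-scale Hessians (in `V` as in (202), in `K` as in (219)) is the same Neumann argument.  (218)∕(219)
ran that argument on the road's concrete kernels; this file states it abstractly so that successors call ONE lemma: (217)'s
`decaying_right_inverse` on `(T, M, E)` (right inverse with the fixed point `N + M(EN) = M`) and on the transposed data `(Tᵗ, Mᵗ, Eᵗ)` (the
`ℓ¹` distance is symmetric, `MT = 1` becomes `TᵗMᵗ = 1`), (217)'s `L = N` for two-sidedness and for uniqueness on either side (`T + E` is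
bounded by `C_T + η`), and (219)'s `fixed_point_lipschitz` for `|N − M| ≤ C_M′·L_E·2C_M′e^{−ν|b−c|₁} = 2C_M′θe^{−ν|b−c|₁}`.

WHAT IS PROVED ([folklore]): §1 **`two_sided_decaying_inverse`** (THE END: for all constants and kernels as above: `∃ N` with the profile
bound, `(T+E)N = 1` and `N(T+E) = 1` with summable rows, the bound on `N − M`, and uniqueness against every decaying right inverse and every
decaying left inverse); §2 toy.

HONEST (what this is NOT).  Abstract kernel algebra (rows and profiles; no operator norms, no `ℓ²`, no symmetry claims); nothing of the
torus → `ℤ^d` limit itself; nothing of the covariant propagators of [B4]–[B6]; nothing of Bałaban's asserted.  BY-NAME EFFECT ON THE WALL: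
NONE.  NE7b NOT PRINTED ∕ NOT PROVED; spine PROVED 0∕9; rung (B)+1 — the programme's measures remain FINITE-torus statements; NOT the mass
gap, NOT Clay.  HONEST DEPENDENCY: continuum YM on T⁴ ⇐ BetaPertH ∧ nine spine estimates (0∕9 proved); BetaPertH ⇐ (D1) ∧ (D4) ∧ CAP+tail;
G-an2-4 gates asym, D1 and NE2∕3∕4.
-/

set_option autoImplicit false

noncomputable section

namespace Summit.QuantumFields.BalabanUV.T4Continuum.NE7b.SupZdKernelNeumannTwoSided

open Real Filter Topology
open scoped ENNReal
open Literature.MathematicalPhysics.QuantumFieldTheory.Balaban1983to89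
open B6QGQLower276 (X)
open SupZdCoarseForm (natAbs_sub_comm_sum)
open SupZdKernelNeumann (decaying_right_inverse left_inverse_eq_right_inverse)
open SupZdPerturbedCoarseInverseLipschitz (fixed_point_lipschitz)

variable {d : ℕ}

/-! ## §1. THE END: two-sided decaying inverses are stable under small decaying perturbations -/

/-- **TWO-SIDED DECAYING INVERSES ARE STABLE**: kernels `T, M` on `ℤ^d` with `|T(b,c)| ≤ C_Te^{−δ_T|b−c|₁}`, `|M(b,c)| ≤ C_Me^{−δ_M|b−c|₁}`,
`TM = 1 = MT` (rows), a perturbation `|E(b,c)| ≤ ηe^{−γ_E|b−c|₁}`, a rate `0 < ν < min(δ_M, γ_E)` and the smallness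
`θ = (C_Me^{νd}K_{δ_M−ν})(ηe^{νd}K_{γ_E−ν}) ≤ 1∕2` ⟹ `T + E` has a kernel `N` with `|N(b,c)| ≤ 2C_M′e^{−ν|b−c|₁}` (`C_M′ = C_Me^{νd}K_{δ_M−ν}`),
`(T+E)N = 1 = N(T+E)` (rows absolutely convergent), `|N − M| ≤ 2C_M′θ·e^{−ν|b−c|₁}`, and `N` is the ONLY exponentially decaying right inverse
and the ONLY exponentially decaying left inverse of `T + E` — (217)'s engine on the data and on the TRANSPOSED data, (217)'s `L = N`, (219)'s
fixed-point bound; (218)∕(219) are the instance `T = T_0`, `M = T_0⁻¹`, `E = T_K − T_0` of the road. [folklore] -/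
theorem two_sided_decaying_inverse {CT δT CM δM η γE ν : ℝ} (hCT : 0 ≤ CT) (hδT : 0 < δT) (hCM : 0 ≤ CM) (hη : 0 ≤ η)
    (hν : 0 < ν) (hνM : ν < δM) (hνE : ν < γE) (T M E : X d → X d → ℝ)
    (hT : ∀ b c, |T b c| ≤ CT * exp (-(δT * ∑ i, (((b i - c i).natAbs : ℕ) : ℝ))))
    (hMd : ∀ b c, |M b c| ≤ CM * exp (-(δM * ∑ i, (((b i - c i).natAbs : ℕ) : ℝ))))
    (hE : ∀ b c, |E b c| ≤ η * exp (-(γE * ∑ i, (((b i - c i).natAbs : ℕ) : ℝ))))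
    (hTM : ∀ b c, ∑' b' : X d, T b b' * M b' c = if b = c then 1 else 0)
    (hMT : ∀ b c, ∑' b' : X d, M b b' * T b' c = if b = c then 1 else 0)
    (hsmall : (CM * exp (ν * d) * (2 * (1 - exp (-(δM - ν)))⁻¹) ^ d) * (η * exp (ν * d) * (2 * (1 - exp (-(γE - ν)))⁻¹) ^ d) ≤ 1 / 2) :
    ∃ N : X d → X d → ℝ,
      (∀ b c, |N b c| ≤ 2 * (CM * exp (ν * d) * (2 * (1 - exp (-(δM - ν)))⁻¹) ^ d) * exp (-(ν * ∑ i, (((b i - c i).natAbs : ℕ) : ℝ)))) ∧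
      (∀ b c, Summable (fun b' : X d => (T b b' + E b b') * N b' c) ∧
        ∑' b' : X d, (T b b' + E b b') * N b' c = if b = c then 1 else 0) ∧
      (∀ b c, Summable (fun b' : X d => N b b' * (T b' c + E b' c)) ∧
        ∑' b' : X d, N b b' * (T b' c + E b' c) = if b = c then 1 else 0) ∧
      (∀ b c, |N b c - M b c| ≤ 2 * (CM * exp (ν * d) * (2 * (1 - exp (-(δM - ν)))⁻¹) ^ d)
        * ((CM * exp (ν * d) * (2 * (1 - exp (-(δM - ν)))⁻¹) ^ d) * (η * exp (ν * d) * (2 * (1 - exp (-(γE - ν)))⁻¹) ^ d))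
        * exp (-(ν * ∑ i, (((b i - c i).natAbs : ℕ) : ℝ)))) ∧
      (∀ (N' : X d → X d → ℝ) (C' ν' : ℝ), 0 ≤ C' → 0 < ν' →
        (∀ b c, |N' b c| ≤ C' * exp (-(ν' * ∑ i, (((b i - c i).natAbs : ℕ) : ℝ)))) →
        ((∀ b c, ∑' b' : X d, (T b b' + E b b') * N' b' c = if b = c then 1 else 0) → ∀ b c, N' b c = N b c) ∧
        ((∀ b c, ∑' b' : X d, N' b b' * (T b' c + E b' c) = if b = c then 1 else 0) → ∀ b c, N' b c = N b c)) := by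
  classical
  have hγE : 0 < γE := hν.trans hνE
  have hKM : 0 < (2 * (1 - exp (-(δM - ν)))⁻¹) ^ d := pow_pos (mul_pos two_pos (inv_pos.2 (sub_pos.2 (exp_lt_one_iff.2 (by linarith))))) d
  have hKE : 0 < (2 * (1 - exp (-(γE - ν)))⁻¹) ^ d := pow_pos (mul_pos two_pos (inv_pos.2 (sub_pos.2 (exp_lt_one_iff.2 (by linarith))))) d
  obtain ⟨CP, hCP⟩ : ∃ CP : ℝ, CP = CM * exp (ν * d) * (2 * (1 - exp (-(δM - ν)))⁻¹) ^ d := ⟨_, rfl⟩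
  have hCP0 : 0 ≤ CP := by rw [hCP]; positivity
  obtain ⟨LE, hLE⟩ : ∃ LE : ℝ, LE = η * exp (ν * d) * (2 * (1 - exp (-(γE - ν)))⁻¹) ^ d := ⟨_, rfl⟩
  have hLE0 : 0 ≤ LE := by rw [hLE]; positivity
  rw [← hCP, ← hLE] at hsmall ⊢
  -- `T + E` is bounded
  have hAb : ∀ b c, |T b c + E b c| ≤ CT + η := fun b c =>
    (abs_add_le _ _).trans (add_le_add
      ((hT b c).trans (mul_le_of_le_one_right hCT (exp_le_one_iff.2 (neg_nonpos.2 (by positivity)))))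
      ((hE b c).trans (mul_le_of_le_one_right hη (exp_le_one_iff.2 (neg_nonpos.2 (by positivity))))))
  have hite : ∀ b c : X d, (if c = b then (1 : ℝ) else 0) = if b = c then 1 else 0 := by
    intro b c
    by_cases h : b = c
    · rw [if_pos h, if_pos h.symm]
    · rw [if_neg h, if_neg fun h' => h h'.symm]
  -- (217) on the data: the decaying RIGHT inverse with its fixed point
  obtain ⟨N, hNd, hNfix, hNid⟩ := decaying_right_inverse (d := d) hCT hδT hCM hη hν hνM hνE T M E hT hMd hE hTM
    (by rw [hCP, hLE] at hsmall; exact hsmall)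
  rw [← hCP] at hNd
  have hright : ∀ b c, Summable (fun b' : X d => (T b b' + E b b') * N b' c) ∧
      ∑' b' : X d, (T b b' + E b b') * N b' c = if b = c then 1 else 0 := fun b c =>
    ⟨(hNid b c).2.2.1, (hNid b c).2.2.2.2⟩
  -- (217) on the TRANSPOSED data: a decaying LEFT inverse
  have hTt : ∀ b c, |T c b| ≤ CT * exp (-(δT * ∑ i, (((b i - c i).natAbs : ℕ) : ℝ))) := fun b c => by
    rw [natAbs_sub_comm_sum]; exact hT c b
  have hMt : ∀ b c, |M c b| ≤ CM * exp (-(δM * ∑ i, (((b i - c i).natAbs : ℕ) : ℝ))) := fun b c => by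
    rw [natAbs_sub_comm_sum]; exact hMd c b
  have hEt : ∀ b c, |E c b| ≤ η * exp (-(γE * ∑ i, (((b i - c i).natAbs : ℕ) : ℝ))) := fun b c => by
    rw [natAbs_sub_comm_sum]; exact hE c b
  have hTMt : ∀ b c, ∑' b' : X d, T b' b * M c b' = if b = c then 1 else 0 := fun b c => by
    rw [show (fun b' : X d => T b' b * M c b') = fun b' => M c b' * T b' b from funext fun _ => mul_comm _ _, hMT c b]
    exact hite b c
  obtain ⟨N', hN'd, -, hN'id⟩ := decaying_right_inverse (d := d) hCT hδT hCM hη hν hνM hνE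
    (fun b c => T c b) (fun b c => M c b) (fun b c => E c b) hTt hMt hEt hTMt (by rw [hCP, hLE] at hsmall; exact hsmall)
  rw [← hCP] at hN'd
  have hleft' : ∀ b c, Summable (fun b' : X d => N' b' b * (T b' c + E b' c)) ∧
      ∑' b' : X d, N' b' b * (T b' c + E b' c) = if b = c then 1 else 0 := by
    intro b c
    obtain ⟨-, -, hs, -, hid⟩ := hN'id c b
    rw [hite] at hid
    have e : (fun b' : X d => (T b' c + E b' c) * N' b' b) = fun b' => N' b' b * (T b' c + E b' c) := funext fun _ => mul_comm _ _
    rw [e] at hs hid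
    exact ⟨hs, hid⟩
  -- (217): left inverse = right inverse
  have hCN : 0 ≤ 2 * CP := by positivity
  have hLd : ∀ b c, |N' c b| ≤ 2 * CP * exp (-(ν * ∑ i, (((b i - c i).natAbs : ℕ) : ℝ))) := fun b c => by
    rw [natAbs_sub_comm_sum]; exact hN'd c b
  have hLN : ∀ b c, N' c b = N b c := fun b c =>
    left_inverse_eq_right_inverse (d := d) hCN hν (by positivity) hCN hν (fun b c => T b c + E b c) (fun b c => N' c b) N hAb
      hLd hNd (fun b c => (hright b c).2) (fun b c => (hleft' b c).2) b c
  have hleft : ∀ b c, Summable (fun b' : X d => N b b' * (T b' c + E b' c)) ∧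
      ∑' b' : X d, N b b' * (T b' c + E b' c) = if b = c then 1 else 0 := by
    intro b c
    have h := hleft' b c
    simp only [hLN] at h
    exact h
  refine ⟨N, hNd, hright, hleft, fun b c => ?_, fun N'' C' ν' hC' hν' hN''d => ⟨fun hr b c => ?_, fun hl b c => ?_⟩⟩
  · -- the fixed-point bound ((219) §1)
    have h := fixed_point_lipschitz (d := d) hCM hη hν hνM hνE M E N hMd hE hNd (fun b c => (hNfix b c).2.2) b c
    rw [← hCP, ← hLE] at h
    calc _ ≤ _ := h
      _ = _ := by ring
  · exact (left_inverse_eq_right_inverse (d := d) hCN hν (by positivity) hC' hν' (fun b c => T b c + E b c) N N'' hAb hNd hN''d hr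
      (fun b c => (hleft b c).2) b c).symm
  · exact left_inverse_eq_right_inverse (d := d) hC' hν' (by positivity) hCN hν (fun b c => T b c + E b c) N'' N hAb hN''d hNd
      (fun b c => (hright b c).2) hl b c

/-! ## §2. Toy -/

/-- Toy (`d = 1`): the trivial perturbation `E = 0` of `T = M = δ` — the lemma returns a two-sided decaying inverse (necessarily `δ` again, by
its own uniqueness clause); here only the shape of the call is exercised. -/
example (hs : ((1 : ℝ) * exp (1 * (1 : ℕ)) * (2 * (1 - exp (-(2 - 1)))⁻¹) ^ 1) * (0 * exp (1 * (1 : ℕ)) * (2 * (1 - exp (-(2 - 1)))⁻¹) ^ 1) ≤ 1 / 2)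
    (hδ : ∀ b c : X 1, ∑' b' : X 1, (if b = b' then (1 : ℝ) else 0) * (if b' = c then (1 : ℝ) else 0) = if b = c then 1 else 0) :
    ∃ N : X 1 → X 1 → ℝ, ∀ b c, |N b c| ≤ 2 * (1 * exp (1 * (1 : ℕ)) * (2 * (1 - exp (-(2 - 1)))⁻¹) ^ 1)
      * exp (-(1 * ∑ i, (((b i - c i).natAbs : ℕ) : ℝ))) := by
  have hdec : ∀ b c : X 1, |(if b = c then (1 : ℝ) else 0)| ≤ 1 * exp (-(2 * ∑ i, (((b i - c i).natAbs : ℕ) : ℝ))) := by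
    intro b c
    split_ifs with h
    · rw [h]; simp
    · rw [abs_zero]; positivity
  have h0 : ∀ b c : X 1, |(0 : ℝ)| ≤ 0 * exp (-(2 * ∑ i, (((b i - c i).natAbs : ℕ) : ℝ))) := fun b c => by rw [abs_zero, zero_mul]
  obtain ⟨N, hN, -⟩ := two_sided_decaying_inverse (d := 1) zero_le_one two_pos zero_le_one le_rfl one_pos one_lt_two one_lt_two
    (fun b c => if b = c then (1 : ℝ) else 0) (fun b c => if b = c then (1 : ℝ) else 0) (fun _ _ => 0) hdec hdec h0 hδ hδ hs
  exact ⟨N, hN⟩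

end Summit.QuantumFields.BalabanUV.T4Continuum.NE7b.SupZdKernelNeumannTwoSided
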